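import Literature.MathematicalPhysics.QuantumFieldTheory.Balaban1983to89.B6Prop26KLevelAssemblyV1PerCube
import Literature.MathematicalPhysics.QuantumFieldTheory.Balaban1983to89.B6PadLevelV1

/-!
# `Balaban1983to89.B6Prop26KLevelAssemblyPadV1` — T. Bałaban, *Propagators and renormalization transformations for lattice gauge theories. II*,
# Commun. Math. Phys. **96** (1984) 223–250 [Balaban1984PropagatorsII], Prop. 2.6 (2.136)₁ p. 247 for the GENUINE `k`-level `G = Δ_a⁻¹` on the V1
# torus FOR EVERY ODD `L ≥ 5` — the placement hypothesis of r03's assembly DISCHARGED BY LEVEL PADDING (`…B6PadLevelV1`): the cubes of the padded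
# family `padT D` (one more, empty, level) all lie below its top level, so r03's `placed_of_lt` places every one of them, and the conclusion for the
# padded family IS the conclusion for `D` (`SameOm.GE_eq`: the same `G`; `hasMajorant_of_pad`, `dist_eT`, `pref_eT`: the same blocks and distance)

statement-level skeleton of published theorems with citation tags; proofs where landed; nothing here is a claim about the Yang–Mills mass gap

PDF held: `paper:balaban1984-cmp96-propagators-rt-ii` (journal page = PDF page + 222): p. 247 [PDF 25] ((2.133)–(2.136), Prop. 2.6), p. 224 [PDF 2]
((2.1)–(2.4), *"we admit the case when some domains Ω_j are equal to T_η"*), p. 229 [PDF 7] ((2.36)), p. 238–239 [PDF 16–17] ((2.88)–(2.94)); read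
from the tree transcriptions in the imported modules.

CITATION HEADER (lean-in-tree rule) — WHAT IS REPRODUCED.  Phase-2 file of the `lit-balaban` typed skeleton (HOME `run/shared/lean/pub/lit-balaban/`), seat
**p38 gen 29** (literature-prover-lit-balaban-p38-g29-0) for the row owner r03's (R6) of B6-CLOSURE §5 item 15 («general-L top-cube placement via `ccAt`
(L = 5 ∧ P′ ≥ 12 is automatic)»); SKELETON rows **B6.Prop2.6** × B6.Eq2.134 × B6.Eq2.36 (cells only; decls of record untouched; referee ref-4).  IMPORTS BY
NAME, restating nothing: `…B6Prop26KLevelAssemblyV1PerCube` (p38 g29: `prop26_2136_kLevel_assembly_line3` — r03's `prop26_2136_kLevel_assembly_nbig` with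
(ii) `hMout` and (iii) the line-1 sizes/supports discharged), `…B6Prop26KLevelAssemblyV1` (r03 g21 v1.4: `prop26_2136_kLevel_final_le`, the rate a parameter), `…B6PadLevelV1` (p38 g29: `padT`, `hN_pad`, `placed_pad`, `sameOm_domT_pad`, `SameOm.GE_eq`,
`SameOm.idxB`, `eT`, `dist_eT`, `pref_eT`, `hasMajorant_of_pad`, `globalBand_pad`).

## WHAT THIS FILE CERTIFIES (kernel-checked, 0 sorry, standard axioms; THEOREMS ONLY — no `def`, no `def … : Prop`, no new named fact)

**`prop26_2136_kLevel_assembly_pad_line3`** (fixed rate) and **`prop26_2136_kLevel_final_pad_le`** (r03's rate-parametric `prop26_2136_kLevel_final_le`,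
`σ ≤ σ₀`, at the padded family) — PROPOSITION 2.6, ENTRY (2.136)₁, FOR THE GENUINE k-LEVEL `G = GE (domT hN D hk)` ON THE V1 TORUS, EVERY ODD
`L ≥ 5`, NO PLACEMENT HYPOTHESIS: for the weight band `[b₀, b₁]` there is `σ > 0`; for every Lemma-2.1 budget `(α, N₀)` and line-3 constants `C_D ≥ 0`,
`c_D > 0` there are `A ≥ 0`, `M₁ > 0` such that — on every V1 torus (`hN`, p21's `D`, `k ≥ 1`, `k + 1 ≤ m + K`, `M_h = L^a ≥ 8`, `R ≥ 2L²`, `L ≥ 5`,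
`P′ = L·P″` with `P″ ≥ 5`, `L·M_h ≥ M₁`, `N₀ + 1 ≤ R·L·M_h`, the (2.59)-shape threshold), for `c′ ≠ 0` and weights in the global band, GIVEN the line-3
majorant (iv) for the members of the cubes of the PADDED family `padT D` (all placed: `placed_pad`; its level-`< k` members are those of `D` verbatim, its
level-`k` members are the top cubes of `D` charted at `S_k`-index `∈ [2L, 3L)`) — `HasMajorant (geomT D) (blkV1 hN D) G (A·(L^{j(y)}/c′)²·e^{−δ₃ d_T(y,y′)})`,
`δ₃ = delta3 α (2σ)`.  Proof: `prop26_2136_kLevel_assembly_line3` applied to `padT D` (`k + 1` levels, all cubes placed, weights `w ∘ idxB`), then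
`SameOm.GE_eq` (the padded family has LITERALLY the same `G`) and `hasMajorant_of_pad` + `dist_eT` + `pref_eT` (the same blocks, block map, distance (2.46)
and prefactor).  v1.1 (§3): **`prop26_2136_kLevel_final_pad_M`** / **`prop26_2136_kLevel_final_pad_M_V1`** — the same from r03's v1.5 `prop26_2136_kLevel_final_M`
(for `α > 0` the Lemma-2.1 exponent `N₀` is chosen inside; ONE size threshold `M₂ ≤ L·M_h` remains), at the padded family resp. on the original data.

## HONEST SCOPE / DIVERGENCES

(1) Displayed: the line-3 majorant (iv) (p38/p22 by-parts route, in progress) — stated for the cubes/members of `padT D` (whoever proves (iv) for every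
admissible torus family proves it for `padT D`), and the Lemma-2.1 budget.  (2) `P′ = L·P″`, `P″ ≥ 5`, `k + 1 ≤ m + K`: in the V1 setting `N₀ = 2L^{m+K}`
forces `P′ ∈ {2L^n}`, so these hold as soon as `P′ ≥ 5L` (print: the torus is as large as needed); `k ≥ 1` (for `k = 1` the padded family has the two
levels the assembly wants).  (3) `L ≥ 5` remains (the band lemma of `B6CubeInDecayV1`; `L = 3` needs the re-centred window) — what is removed here is the
restriction `L ≤ 5` of `placed_top`, i.e. the k-level (2.136)₁ now holds for EVERY odd `L ≥ 5` modulo line 3.  (4) Constants `A`, `M₁` on `d, L, b₀, b₁, α, N₀,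
C_D, c_D` only.  (5) Entries (2.136)₂₋₄ / (2.137)–(2.140) untouched; integer torus; nothing on d = 4 or the continuum; NOT summit progress.  Unit
`lit-balaban-p38` (gen 29), 2026-08-23.
-/

open scoped BigOperators
open Finset

namespace Literature.MathematicalPhysics.QuantumFieldTheory.Balaban1983to89.B6Prop26KLevelAssemblyPadV1

open B4Reflection242 (boxDom)
open B6MultiLevelBoxOperator (N0)
open B6MultiLevelTorusOperator (TDomains)
open B6Cover236MultiLevelBlocks (cubes)
open B6Geom246MultiLevelTorus (geomT)
open B8Ineq192MultiLevelTorus (geomTB)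
open B6RandomWalk (HasMajorant delta3)
open B6Prop26Gluing (mulOp)
open B6Ineq2133TwoScaleV1 (onFun)
open B6GlobalChartV1 (PV domT blkV1)
open B6SectAOperatorsV1 (dE dsE RE BondIdx)
open B6SectAVectorModelV1 (GE)
open B6Prop26KLevelSkeletonV1 (hB zB pref)
open B6CubeWindowV1 (Pl GlobalBand band_le one_le_of_eight_le four_le_of_five_le)
open B6Prop26KLevelAssemblyV1 (prop26_2136_kLevel_final_le)
open B6Prop26KLevelAssemblyV1PerCube (prop26_2136_kLevel_assembly_line3)
open B6PadLevelV1 (padT hN_pad placed_pad sameOm_domT_pad SameOm.idxB SameOm.GE_eq eT dist_eT pref_eT hasMajorant_of_pad globalBand_pad)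

noncomputable section

variable {d ℓ : ℕ} {hd : 1 ≤ d + 1} {hL : Odd (ℓ + 1) ∧ 1 < ℓ + 1} {m K : ℕ} {Mh k R : ℕ} {P' P'' : Fin (d + 1) → ℕ}

/-! ## §1  The k-level (2.136)₁ for every odd `L ≥ 5`: placement discharged by padding -/

section Pad

open Classical in
/-- **PROPOSITION 2.6, ENTRY (2.136)₁, FOR THE GENUINE k-LEVEL `G = Δ_a⁻¹` ON THE V1 TORUS, EVERY ODD `L ≥ 5`, ONLY LINE 3 DISPLAYED.**  The placement
hypothesis of r03's assembly (all cubes `Placed`, automatic only for `L = 5`) is DISCHARGED by padding the torus family with one empty level (`padT D`,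
`P′ = L·P″`): every cube of the padded cover lies below its top level (`placed_pad`), the padded family has the same `Λ_j`, `𝔅`, `Δ_a`, `G` (`SameOm.GE_eq`)
and the same blocks and distance (2.46) (`hasMajorant_of_pad`, `dist_eT`, `pref_eT`).  Displayed: the line-3 majorant (iv) for the members of the cubes of
`padT D` (weights `w ∘ idxB`) and the Lemma-2.1 budget; conclusion: `|G(x,x′)| ≤ A·(L^{j(y)}/c′)²·e^{−δ₃ d_T(y,y′)}` blockwise for the genuine
`G = GE (domT hN D hk)`, `δ₃ = delta3 α (2σ)`.
[cite: Balaban1984PropagatorsII, Prop. 2.6 (2.136) p.247, (2.133)–(2.135) p.247, (2.88)–(2.94) pp.238–239, (2.36) p.229, (2.1)–(2.4) p.224, Lemma 2.1 p.234] -/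
theorem prop26_2136_kLevel_assembly_pad_line3 (d ℓ : ℕ) (hd : 1 ≤ d + 1) (hL : Odd (ℓ + 1) ∧ 1 < ℓ + 1) {b₀ b₁ : ℝ} (hb₀ : 0 < b₀) (hb₁ : b₀ ≤ b₁) :
    ∃ σ : ℝ, 0 < σ ∧ ∀ (α : ℝ), 0 ≤ α → α ≤ 1 → ∀ (N₀ : ℕ), 0 < N₀ → ∀ {CD cD : ℝ}, 0 ≤ CD → 0 < cD →
    ∃ A M₁ : ℝ, 0 ≤ A ∧ 0 < M₁ ∧
    ∀ (m K : ℕ) {Mh k R : ℕ} {P' P'' : Fin (d + 1) → ℕ}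
      (hN : ∀ μ, N0 ℓ Mh k P' μ = (PV d ℓ m K hd hL).sitesPerDir 0) (D : TDomains d ℓ Mh k P' R) (hk : k ≤ m + K) (hk' : k + 1 ≤ m + K) (_ : 1 ≤ k)
      {a : ℕ} (hMha : Mh = (ℓ + 1) ^ a) (hM8 : 8 ≤ Mh) (_ : 2 * (ℓ + 1) ^ 2 ≤ R)
      (hLP : ∀ μ, P' μ = (ℓ + 1) * P'' μ) (hP5 : ∀ μ, 5 ≤ P'' μ) (_ : 4 ≤ ℓ)
      (_ : M₁ ≤ ((ℓ : ℝ) + 1) * Mh) (_ : N₀ + 1 ≤ R * ((ℓ + 1) * Mh))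
      (_ : Real.exp (-(α * σ)) * ((ℓ : ℝ) + 1) ^ ((2 * (d + 1 : ℕ) : ℝ) / N₀) < 1)
      {cf : ℝ} (hcf : cf ≠ 0) {w : BondIdx (domT hN D hk) → ℝ} (hw : ∀ i, 0 < w i) (_ : GlobalBand b₀ b₁ cf w)
      -- line 3 (p38/p22) for the members of the cubes of the PADDED family (every cube placed: `placed_pad`)
      (_ : ∀ c : ↥(cubes (padT D hLP).toDomains), HasMajorant (g := geomTB (padT D hLP)) (blkV1 (hN_pad hN hLP) (padT D hLP))
        (mulOp (zB (hN_pad hN hLP) (padT D hLP) (one_le_of_eight_le hM8) (four_le_of_five_le hP5) c) *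
          (onFun (dE (P := PV d ℓ m K hd hL) cf ∘ₗ (LinearMap.id - RE (domT (hN_pad hN hLP) (padT D hLP) hk') cf) ∘ₗ dsE cf) -
            Pl (hN_pad hN hLP) hk' (one_le_of_eight_le hM8) (four_le_of_five_le hP5) hMha c (band_le (d := d) (ℓ := ℓ) hb₀ hb₁)
              (placed_pad D hLP hP5 c) (w ∘ (sameOm_domT_pad hN D hk hLP hk').idxB) cf) *
          mulOp (hB (hN_pad hN hLP) (padT D hLP) c))
        (fun y y'' => CD * cf ^ 2 * Real.exp (-(cD * (geomTB (padT D hLP)).M)) / (geomTB (padT D hLP)).len y ^ 2 *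
          Real.exp (-((2 * σ) * (geomTB (padT D hLP)).dist y y'')))),
      HasMajorant (g := geomT D) (blkV1 hN D) (onFun (GE (domT hN D hk) hcf hw))
        (fun y y' => A * pref cf y * Real.exp (-(delta3 α (2 * σ) * (geomT D).dist y y'))) := by
  obtain ⟨σ, hσ, h⟩ := prop26_2136_kLevel_assembly_line3 d ℓ hd hL hb₀ hb₁
  refine ⟨σ, hσ, fun α hα0 hα1 N₀ hN₀ CD cD hCD hcD => ?_⟩
  obtain ⟨A, M₁, hA, hM₁, h2⟩ := h α hα0 hα1 N₀ hN₀ hCD hcD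
  refine ⟨A, M₁, hA, hM₁, ?_⟩
  intro m K Mh k R P' P'' hN D hk hk' hk1 a hMha hM8 hR2 hLP hP5 hℓ hLM hRM hθ cf hcf w hw hwb hD3
  have hS := sameOm_domT_pad hN D hk hLP hk'
  have hw' : ∀ i, 0 < (w ∘ hS.idxB) i := fun i => hw _
  -- the assembly for the padded family (k + 1 levels, every cube placed)
  have hpad := h2 m K (hN_pad hN hLP) (padT D hLP) hk' (by omega) hMha hM8 hR2 hP5 hℓ (placed_pad D hLP hP5) hLM hRM hθ hcf hw'
    (globalBand_pad D hLP hN hk hk' hwb) hD3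
  -- the padded family has literally the same `G`
  rw [hS.GE_eq hcf hw hw'] at hpad
  -- the same blocks, block map, distance and prefactor
  have hK : (fun a b : (geomT D).Site => A * pref cf (D := padT D hLP) (eT D hLP a) *
      Real.exp (-(delta3 α (2 * σ) * (geomT (padT D hLP)).dist (eT D hLP a) (eT D hLP b)))) =
      fun y y' => A * pref cf y * Real.exp (-(delta3 α (2 * σ) * (geomT D).dist y y')) := by
    funext a b
    rw [dist_eT, pref_eT]
  rw [← hK]
  exact hasMajorant_of_pad D hLP hN hpad

open Classical in
/-- **THE SAME WITH THE RATE AS A PARAMETER** — r03's `prop26_2136_kLevel_final_le` (`∃ σ₀ > 0, ∀ σ ∈ (0, σ₀], …`: a line-3 majorant proved at its own rate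
`ρ₃` is consumed at `σ := min σ₀ (ρ₃/2)`) at the padded family: every odd `L ≥ 5`, no placement hypothesis, only the line-3 majorant (iv) displayed.
[cite: Balaban1984PropagatorsII, Prop. 2.6 (2.136) p.247, (2.133)–(2.135) p.247, (2.88)–(2.94) pp.238–239, (2.36) p.229, (2.1)–(2.4) p.224, Lemma 2.1 p.234] -/
theorem prop26_2136_kLevel_final_pad_le (d ℓ : ℕ) (hd : 1 ≤ d + 1) (hL : Odd (ℓ + 1) ∧ 1 < ℓ + 1) {b₀ b₁ : ℝ} (hb₀ : 0 < b₀) (hb₁ : b₀ ≤ b₁) :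
    ∃ σ₀ : ℝ, 0 < σ₀ ∧ ∀ (σ : ℝ), 0 < σ → σ ≤ σ₀ → ∀ (α : ℝ), 0 ≤ α → α ≤ 1 → ∀ (N₀ : ℕ), 0 < N₀ → ∀ {CD cD : ℝ}, 0 ≤ CD → 0 < cD →
    ∃ A M₁ : ℝ, 0 ≤ A ∧ 0 < M₁ ∧
    ∀ (m K : ℕ) {Mh k R : ℕ} {P' P'' : Fin (d + 1) → ℕ}
      (hN : ∀ μ, N0 ℓ Mh k P' μ = (PV d ℓ m K hd hL).sitesPerDir 0) (D : TDomains d ℓ Mh k P' R) (hk : k ≤ m + K) (hk' : k + 1 ≤ m + K) (_ : 1 ≤ k)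
      {a : ℕ} (hMha : Mh = (ℓ + 1) ^ a) (hM8 : 8 ≤ Mh) (_ : 2 * (ℓ + 1) ^ 2 ≤ R)
      (hLP : ∀ μ, P' μ = (ℓ + 1) * P'' μ) (hP5 : ∀ μ, 5 ≤ P'' μ) (_ : 4 ≤ ℓ)
      (_ : M₁ ≤ ((ℓ : ℝ) + 1) * Mh) (_ : N₀ + 1 ≤ R * ((ℓ + 1) * Mh))
      (_ : Real.exp (-(α * σ)) * ((ℓ : ℝ) + 1) ^ ((2 * (d + 1 : ℕ) : ℝ) / N₀) < 1)
      {cf : ℝ} (hcf : cf ≠ 0) {w : BondIdx (domT hN D hk) → ℝ} (hw : ∀ i, 0 < w i) (_ : GlobalBand b₀ b₁ cf w)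
      (_ : ∀ c : ↥(cubes (padT D hLP).toDomains), HasMajorant (g := geomTB (padT D hLP)) (blkV1 (hN_pad hN hLP) (padT D hLP))
        (mulOp (zB (hN_pad hN hLP) (padT D hLP) (one_le_of_eight_le hM8) (four_le_of_five_le hP5) c) *
          (onFun (dE (P := PV d ℓ m K hd hL) cf ∘ₗ (LinearMap.id - RE (domT (hN_pad hN hLP) (padT D hLP) hk') cf) ∘ₗ dsE cf) -
            Pl (hN_pad hN hLP) hk' (one_le_of_eight_le hM8) (four_le_of_five_le hP5) hMha c (band_le (d := d) (ℓ := ℓ) hb₀ hb₁)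
              (placed_pad D hLP hP5 c) (w ∘ (sameOm_domT_pad hN D hk hLP hk').idxB) cf) *
          mulOp (hB (hN_pad hN hLP) (padT D hLP) c))
        (fun y y'' => CD * cf ^ 2 * Real.exp (-(cD * (geomTB (padT D hLP)).M)) / (geomTB (padT D hLP)).len y ^ 2 *
          Real.exp (-((2 * σ) * (geomTB (padT D hLP)).dist y y'')))),
      HasMajorant (g := geomT D) (blkV1 hN D) (onFun (GE (domT hN D hk) hcf hw))
        (fun y y' => A * pref cf y * Real.exp (-(delta3 α (2 * σ) * (geomT D).dist y y'))) := by
  obtain ⟨σ₀, hσ₀, h⟩ := prop26_2136_kLevel_final_le d ℓ hd hL hb₀ hb₁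
  refine ⟨σ₀, hσ₀, fun σ hσ0 hσle α hα0 hα1 N₀ hN₀ CD cD hCD hcD => ?_⟩
  obtain ⟨A, M₁, hA, hM₁, h2⟩ := h σ hσ0 hσle α hα0 hα1 N₀ hN₀ hCD hcD
  refine ⟨A, M₁, hA, hM₁, ?_⟩
  intro m K Mh k R P' P'' hN D hk hk' hk1 a hMha hM8 hR2 hLP hP5 hℓ hLM hRM hθ cf hcf w hw hwb hD3
  have hS := sameOm_domT_pad hN D hk hLP hk'
  have hw' : ∀ i, 0 < (w ∘ hS.idxB) i := fun i => hw _
  have hpad := h2 m K (hN_pad hN hLP) (padT D hLP) hk' (by omega) hMha hM8 hR2 hP5 hℓ (placed_pad D hLP hP5) hLM hRM hθ hcf hw'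
    (globalBand_pad D hLP hN hk hk' hwb) hD3
  rw [hS.GE_eq hcf hw hw'] at hpad
  have hK : (fun a b : (geomT D).Site => A * pref cf (D := padT D hLP) (eT D hLP a) *
      Real.exp (-(delta3 α (2 * σ) * (geomT (padT D hLP)).dist (eT D hLP a) (eT D hLP b)))) =
      fun y y' => A * pref cf y * Real.exp (-(delta3 α (2 * σ) * (geomT D).dist y y')) := by
    funext a b
    rw [dist_eT, pref_eT]
  rw [← hK]
  exact hasMajorant_of_pad D hLP hN hpad

end Pad

/-! ## §2  The V1 arithmetic: `N₀ = 2L^{m+K}` forces `P′ = 2L^n`, so `P′ ≥ 5L` gives the padding data -/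

section V1Arith

variable {a : ℕ}

/-- **THE TORUS SIZE IN THE V1 SETTING**: `hN` and `M_h = L^a` give `P′_μ·L^{a+k+1} = 2·L^{m+K}` (`N₀ = L^k·L·M_h·P′ = 2L^{m+K}`).
[cite: Balaban1984PropagatorsII, (2.1) p.224; Balaban1983RegularityDecay, p.572 (T_η with periodic conditions), bookkeeping] -/
theorem P'_mul_pow_eq (hN : ∀ μ, N0 ℓ Mh k P' μ = (PV d ℓ m K hd hL).sitesPerDir 0) (hMha : Mh = (ℓ + 1) ^ a) (μ : Fin (d + 1)) :
    P' μ * (ℓ + 1) ^ (a + k + 1) = 2 * (ℓ + 1) ^ (m + K) := by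
  have h : (ℓ + 1) ^ k * ((ℓ + 1) * (Mh * P' μ)) = 2 * (ℓ + 1) ^ (m + K - 0) := hN μ
  rw [Nat.sub_zero, hMha] at h
  calc P' μ * (ℓ + 1) ^ (a + k + 1) = (ℓ + 1) ^ k * ((ℓ + 1) * ((ℓ + 1) ^ a * P' μ)) := by ring
    _ = 2 * (ℓ + 1) ^ (m + K) := h

/-- `L ≥ 3` (`L` odd, `L > 1`). [cite: Balaban1984PropagatorsII, p.224 («L odd»), bookkeeping] -/
theorem three_le_L (hL : Odd (ℓ + 1) ∧ 1 < ℓ + 1) : 3 ≤ ℓ + 1 := by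
  obtain ⟨r, hr⟩ := hL.1; omega

/-- in the V1 setting `a + k + 1 ≤ m + K` (otherwise `P′·L^{a+k+1} ≥ L^{m+K+1} > 2L^{m+K}`). [cite: Balaban1984PropagatorsII, (2.1) p.224, bookkeeping] -/
theorem akle_of_V1 (hN : ∀ μ, N0 ℓ Mh k P' μ = (PV d ℓ m K hd hL).sitesPerDir 0) (hMha : Mh = (ℓ + 1) ^ a) (hP1 : 1 ≤ P' 0) :
    a + k + 1 ≤ m + K := by
  by_contra hlt
  have h := P'_mul_pow_eq hN hMha 0
  have h1 : (ℓ + 1) ^ (m + K + 1) ≤ (ℓ + 1) ^ (a + k + 1) := Nat.pow_le_pow_right (Nat.succ_pos ℓ) (by omega)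
  have h3 := three_le_L hL
  have e : (ℓ + 1) ^ (m + K + 1) = (ℓ + 1) * (ℓ + 1) ^ (m + K) := by ring
  have hpos : 0 < (ℓ + 1) ^ (m + K) := pow_pos (Nat.succ_pos ℓ) _
  have hY : (ℓ + 1) * (ℓ + 1) ^ (m + K) ≤ (ℓ + 1) ^ (a + k + 1) := e ▸ h1
  have h2 : (ℓ + 1) ^ (a + k + 1) ≤ P' 0 * (ℓ + 1) ^ (a + k + 1) := Nat.le_mul_of_pos_left _ hP1
  have h4 : 3 * (ℓ + 1) ^ (m + K) ≤ (ℓ + 1) * (ℓ + 1) ^ (m + K) := Nat.mul_le_mul_right _ h3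
  linarith

/-- **`P′ = 2L^n`** with `n = m + K − (a + k + 1)`. [cite: Balaban1984PropagatorsII, (2.1) p.224, bookkeeping] -/
theorem P'_eq_of_V1 (hN : ∀ μ, N0 ℓ Mh k P' μ = (PV d ℓ m K hd hL).sitesPerDir 0) (hMha : Mh = (ℓ + 1) ^ a) (hP1 : 1 ≤ P' 0)
    (μ : Fin (d + 1)) : P' μ = 2 * (ℓ + 1) ^ (m + K - (a + k + 1)) := by
  have hle := akle_of_V1 hN hMha hP1
  have h := P'_mul_pow_eq hN hMha μ
  have e : (ℓ + 1) ^ (m + K) = (ℓ + 1) ^ (m + K - (a + k + 1)) * (ℓ + 1) ^ (a + k + 1) := by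
    rw [← pow_add, Nat.sub_add_cancel hle]
  rw [e, ← mul_assoc] at h
  exact Nat.eq_of_mul_eq_mul_right (pow_pos (Nat.succ_pos ℓ) _) h

/-- **`P′ ≥ 5L ⟹ L ∣ P′`**: the padding hypothesis `P′ = L·P″` with `P″ := P′/L`. [cite: Balaban1984PropagatorsII, (2.1) p.224, bookkeeping] -/
theorem hLP_of_V1 (hN : ∀ μ, N0 ℓ Mh k P' μ = (PV d ℓ m K hd hL).sitesPerDir 0) (hMha : Mh = (ℓ + 1) ^ a) (hP : ∀ μ, 5 * (ℓ + 1) ≤ P' μ) :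
    ∀ μ, P' μ = (ℓ + 1) * (P' μ / (ℓ + 1)) := by
  intro μ
  have hP1 : 1 ≤ P' 0 := le_trans (by omega) (hP 0)
  have hPμ := P'_eq_of_V1 hN hMha hP1 μ
  have hn : 1 ≤ m + K - (a + k + 1) := by
    by_contra h0
    have h00 : m + K - (a + k + 1) = 0 := by omega
    rw [h00, pow_zero, mul_one] at hPμ
    have := hP μ
    omega
  have hdvd : (ℓ + 1) ∣ P' μ := by
    rw [hPμ]
    exact Dvd.dvd.mul_left (dvd_pow_self _ (by omega)) 2
  exact (Nat.mul_div_cancel' hdvd).symm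

/-- `P″ = P′/L ≥ 5` for `P′ ≥ 5L`. [cite: Balaban1984PropagatorsII, (2.1) p.224, bookkeeping] -/
theorem hP5_of_V1 (hP : ∀ μ, 5 * (ℓ + 1) ≤ P' μ) : ∀ μ, 5 ≤ P' μ / (ℓ + 1) :=
  fun μ => (Nat.le_div_iff_mul_le (Nat.succ_pos ℓ)).2 (hP μ)

/-- `k + 1 ≤ m + K` in the V1 setting with `P′ ≥ 5L`. [cite: Balaban1984PropagatorsII, (2.1) p.224, bookkeeping] -/
theorem hk'_of_V1 (hN : ∀ μ, N0 ℓ Mh k P' μ = (PV d ℓ m K hd hL).sitesPerDir 0) (hMha : Mh = (ℓ + 1) ^ a) (hP : ∀ μ, 5 * (ℓ + 1) ≤ P' μ) :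
    k + 1 ≤ m + K :=
  le_trans (by omega) (akle_of_V1 hN hMha (le_trans (by omega) (hP 0)))

open Classical in
/-- **PROPOSITION 2.6 (2.136)₁ AT k LEVELS, EVERY ODD `L ≥ 5`, STATED ON THE ORIGINAL DATA**: `prop26_2136_kLevel_final_pad_le` with the padding data
`P″ := P′/L`, `P′ = L·P″`, `P″ ≥ 5`, `k + 1 ≤ m + K` DERIVED from `hN`, `M_h = L^a` and `P′_μ ≥ 5L` (`hLP_of_V1`, `hP5_of_V1`, `hk'_of_V1`) — hypotheses: the
torus (`hN`, `D`, `hk`, `k ≥ 1`, `M_h = L^a ≥ 8`, `R ≥ 2L²`, `P′ ≥ 5L`, `L ≥ 5`, `L·M_h ≥ M₁`, budget), `c′ ≠ 0`, the weight band, and the line-3 majorant (iv)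
for the members of the padded family; conclusion: (2.136)₁ for the genuine `G`, rate `delta3 α (2σ)`, any `σ ≤ σ₀`.
[cite: Balaban1984PropagatorsII, Prop. 2.6 (2.136) p.247, (2.133)–(2.135) p.247, (2.88)–(2.94) pp.238–239, (2.36) p.229, (2.1)–(2.4) p.224, Lemma 2.1 p.234] -/
theorem prop26_2136_kLevel_final_pad_le_V1 (d ℓ : ℕ) (hd : 1 ≤ d + 1) (hL : Odd (ℓ + 1) ∧ 1 < ℓ + 1) {b₀ b₁ : ℝ} (hb₀ : 0 < b₀) (hb₁ : b₀ ≤ b₁) :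
    ∃ σ₀ : ℝ, 0 < σ₀ ∧ ∀ (σ : ℝ), 0 < σ → σ ≤ σ₀ → ∀ (α : ℝ), 0 ≤ α → α ≤ 1 → ∀ (N₀ : ℕ), 0 < N₀ → ∀ {CD cD : ℝ}, 0 ≤ CD → 0 < cD →
    ∃ A M₁ : ℝ, 0 ≤ A ∧ 0 < M₁ ∧
    ∀ (m K : ℕ) {Mh k R : ℕ} {P' : Fin (d + 1) → ℕ}
      (hN : ∀ μ, N0 ℓ Mh k P' μ = (PV d ℓ m K hd hL).sitesPerDir 0) (D : TDomains d ℓ Mh k P' R) (hk : k ≤ m + K) (_ : 1 ≤ k)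
      {a : ℕ} (hMha : Mh = (ℓ + 1) ^ a) (hM8 : 8 ≤ Mh) (_ : 2 * (ℓ + 1) ^ 2 ≤ R) (hP : ∀ μ, 5 * (ℓ + 1) ≤ P' μ) (_ : 4 ≤ ℓ)
      (_ : M₁ ≤ ((ℓ : ℝ) + 1) * Mh) (_ : N₀ + 1 ≤ R * ((ℓ + 1) * Mh))
      (_ : Real.exp (-(α * σ)) * ((ℓ : ℝ) + 1) ^ ((2 * (d + 1 : ℕ) : ℝ) / N₀) < 1)
      {cf : ℝ} (hcf : cf ≠ 0) {w : BondIdx (domT hN D hk) → ℝ} (hw : ∀ i, 0 < w i) (_ : GlobalBand b₀ b₁ cf w)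
      (_ : ∀ c : ↥(cubes (padT D (hLP_of_V1 hN hMha hP)).toDomains),
        HasMajorant (g := geomTB (padT D (hLP_of_V1 hN hMha hP))) (blkV1 (hN_pad hN (hLP_of_V1 hN hMha hP)) (padT D (hLP_of_V1 hN hMha hP)))
        (mulOp (zB (hN_pad hN (hLP_of_V1 hN hMha hP)) (padT D (hLP_of_V1 hN hMha hP)) (one_le_of_eight_le hM8)
            (four_le_of_five_le (hP5_of_V1 hP)) c) *
          (onFun (dE (P := PV d ℓ m K hd hL) cf ∘ₗ
              (LinearMap.id - RE (domT (hN_pad hN (hLP_of_V1 hN hMha hP)) (padT D (hLP_of_V1 hN hMha hP)) (hk'_of_V1 hN hMha hP)) cf) ∘ₗ dsE cf) -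
            Pl (hN_pad hN (hLP_of_V1 hN hMha hP)) (hk'_of_V1 hN hMha hP) (one_le_of_eight_le hM8) (four_le_of_five_le (hP5_of_V1 hP)) hMha c
              (band_le (d := d) (ℓ := ℓ) hb₀ hb₁) (placed_pad D (hLP_of_V1 hN hMha hP) (hP5_of_V1 hP) c)
              (w ∘ (sameOm_domT_pad hN D hk (hLP_of_V1 hN hMha hP) (hk'_of_V1 hN hMha hP)).idxB) cf) *
          mulOp (hB (hN_pad hN (hLP_of_V1 hN hMha hP)) (padT D (hLP_of_V1 hN hMha hP)) c))
        (fun y y'' => CD * cf ^ 2 * Real.exp (-(cD * (geomTB (padT D (hLP_of_V1 hN hMha hP))).M)) /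
          (geomTB (padT D (hLP_of_V1 hN hMha hP))).len y ^ 2 * Real.exp (-((2 * σ) * (geomTB (padT D (hLP_of_V1 hN hMha hP))).dist y y'')))),
      HasMajorant (g := geomT D) (blkV1 hN D) (onFun (GE (domT hN D hk) hcf hw))
        (fun y y' => A * pref cf y * Real.exp (-(delta3 α (2 * σ) * (geomT D).dist y y'))) := by
  obtain ⟨σ₀, hσ₀, h⟩ := prop26_2136_kLevel_final_pad_le d ℓ hd hL hb₀ hb₁
  refine ⟨σ₀, hσ₀, fun σ hσ0 hσle α hα0 hα1 N₀ hN₀ CD cD hCD hcD => ?_⟩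
  obtain ⟨A, M₁, hA, hM₁, h2⟩ := h σ hσ0 hσle α hα0 hα1 N₀ hN₀ hCD hcD
  refine ⟨A, M₁, hA, hM₁, ?_⟩
  intro m K Mh k R P' hN D hk hk1 a hMha hM8 hR2 hP hℓ hLM hRM hθ cf hcf w hw hwb hD3
  exact h2 m K hN D hk (hk'_of_V1 hN hMha hP) hk1 hMha hM8 hR2 (hLP_of_V1 hN hMha hP) (hP5_of_V1 hP) hℓ hLM hRM hθ hcf hw hwb hD3

end V1Arith

/-! ## §3  (v1.1) One size threshold: r03's `prop26_2136_kLevel_final_M` at the padded family -/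

section Budget

open Classical in
/-- **PROPOSITION 2.6 (2.136)₁ AT k LEVELS, EVERY ODD `L ≥ 5`, ONE SIZE THRESHOLD** — r03's v1.5 `prop26_2136_kLevel_final_M` (for `α > 0` the Lemma-2.1
exponent `N₀` is chosen inside; the budget hypotheses collapse to `M₂ ≤ L·M_h`) at the padded family `padT D`, transported back to `D` exactly as in
`prop26_2136_kLevel_final_pad_le`: no placement hypothesis, only the line-3 majorant (iv) displayed, rate `delta3 α (2σ)` for any `σ ≤ σ₀`.
[cite: Balaban1984PropagatorsII, Prop. 2.6 (2.136) p.247, (2.133)–(2.135) p.247, (2.88)–(2.94) pp.238–239, (2.36) p.229, (2.1)–(2.4) p.224, Lemma 2.1 p.234] -/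
theorem prop26_2136_kLevel_final_pad_M (d ℓ : ℕ) (hd : 1 ≤ d + 1) (hL : Odd (ℓ + 1) ∧ 1 < ℓ + 1) {b₀ b₁ : ℝ} (hb₀ : 0 < b₀) (hb₁ : b₀ ≤ b₁) :
    ∃ σ₀ : ℝ, 0 < σ₀ ∧ ∀ (σ : ℝ), 0 < σ → σ ≤ σ₀ → ∀ (α : ℝ), 0 < α → α ≤ 1 → ∀ {CD cD : ℝ}, 0 ≤ CD → 0 < cD →
    ∃ A M₂ : ℝ, 0 ≤ A ∧ 0 < M₂ ∧
    ∀ (m K : ℕ) {Mh k R : ℕ} {P' P'' : Fin (d + 1) → ℕ}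
      (hN : ∀ μ, N0 ℓ Mh k P' μ = (PV d ℓ m K hd hL).sitesPerDir 0) (D : TDomains d ℓ Mh k P' R) (hk : k ≤ m + K) (hk' : k + 1 ≤ m + K) (_ : 1 ≤ k)
      {a : ℕ} (hMha : Mh = (ℓ + 1) ^ a) (hM8 : 8 ≤ Mh) (_ : 2 * (ℓ + 1) ^ 2 ≤ R)
      (hLP : ∀ μ, P' μ = (ℓ + 1) * P'' μ) (hP5 : ∀ μ, 5 ≤ P'' μ) (_ : 4 ≤ ℓ)
      (_ : M₂ ≤ ((ℓ : ℝ) + 1) * Mh)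
      {cf : ℝ} (hcf : cf ≠ 0) {w : BondIdx (domT hN D hk) → ℝ} (hw : ∀ i, 0 < w i) (_ : GlobalBand b₀ b₁ cf w)
      (_ : ∀ c : ↥(cubes (padT D hLP).toDomains), HasMajorant (g := geomTB (padT D hLP)) (blkV1 (hN_pad hN hLP) (padT D hLP))
        (mulOp (zB (hN_pad hN hLP) (padT D hLP) (one_le_of_eight_le hM8) (four_le_of_five_le hP5) c) *
          (onFun (dE (P := PV d ℓ m K hd hL) cf ∘ₗ (LinearMap.id - RE (domT (hN_pad hN hLP) (padT D hLP) hk') cf) ∘ₗ dsE cf) -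
            Pl (hN_pad hN hLP) hk' (one_le_of_eight_le hM8) (four_le_of_five_le hP5) hMha c (band_le (d := d) (ℓ := ℓ) hb₀ hb₁)
              (placed_pad D hLP hP5 c) (w ∘ (sameOm_domT_pad hN D hk hLP hk').idxB) cf) *
          mulOp (hB (hN_pad hN hLP) (padT D hLP) c))
        (fun y y'' => CD * cf ^ 2 * Real.exp (-(cD * (geomTB (padT D hLP)).M)) / (geomTB (padT D hLP)).len y ^ 2 *
          Real.exp (-((2 * σ) * (geomTB (padT D hLP)).dist y y'')))),
      HasMajorant (g := geomT D) (blkV1 hN D) (onFun (GE (domT hN D hk) hcf hw))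
        (fun y y' => A * pref cf y * Real.exp (-(delta3 α (2 * σ) * (geomT D).dist y y'))) := by
  obtain ⟨σ₀, hσ₀, h⟩ := B6Prop26KLevelAssemblyV1.prop26_2136_kLevel_final_M d ℓ hd hL hb₀ hb₁
  refine ⟨σ₀, hσ₀, fun σ hσ0 hσle α hα0 hα1 CD cD hCD hcD => ?_⟩
  obtain ⟨A, M₂, hA, hM₂, h2⟩ := h σ hσ0 hσle α hα0 hα1 hCD hcD
  refine ⟨A, M₂, hA, hM₂, ?_⟩
  intro m K Mh k R P' P'' hN D hk hk' hk1 a hMha hM8 hR2 hLP hP5 hℓ hLM cf hcf w hw hwb hD3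
  have hS := sameOm_domT_pad hN D hk hLP hk'
  have hw' : ∀ i, 0 < (w ∘ hS.idxB) i := fun i => hw _
  have hpad := h2 m K (hN_pad hN hLP) (padT D hLP) hk' (by omega) hMha hM8 hR2 hP5 hℓ (placed_pad D hLP hP5) hLM hcf hw'
    (globalBand_pad D hLP hN hk hk' hwb) hD3
  rw [hS.GE_eq hcf hw hw'] at hpad
  have hK : (fun a b : (geomT D).Site => A * pref cf (D := padT D hLP) (eT D hLP a) *
      Real.exp (-(delta3 α (2 * σ) * (geomT (padT D hLP)).dist (eT D hLP a) (eT D hLP b)))) =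
      fun y y' => A * pref cf y * Real.exp (-(delta3 α (2 * σ) * (geomT D).dist y y')) := by
    funext a b
    rw [dist_eT, pref_eT]
  rw [← hK]
  exact hasMajorant_of_pad D hLP hN hpad

open Classical in
/-- **THE SAME STATED ON THE ORIGINAL DATA** (`P″ := P′/L`, `hLP`, `P″ ≥ 5`, `k + 1 ≤ m + K` derived from `hN`, `M_h = L^a`, `P′ ≥ 5L` as in
`prop26_2136_kLevel_final_pad_le_V1`): every odd `L ≥ 5`, `α > 0`, one size threshold `M₂ ≤ L·M_h`, only the line-3 majorant (iv) displayed.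
[cite: Balaban1984PropagatorsII, Prop. 2.6 (2.136) p.247, (2.133)–(2.135) p.247, (2.88)–(2.94) pp.238–239, (2.36) p.229, (2.1)–(2.4) p.224, Lemma 2.1 p.234] -/
theorem prop26_2136_kLevel_final_pad_M_V1 (d ℓ : ℕ) (hd : 1 ≤ d + 1) (hL : Odd (ℓ + 1) ∧ 1 < ℓ + 1) {b₀ b₁ : ℝ} (hb₀ : 0 < b₀) (hb₁ : b₀ ≤ b₁) :
    ∃ σ₀ : ℝ, 0 < σ₀ ∧ ∀ (σ : ℝ), 0 < σ → σ ≤ σ₀ → ∀ (α : ℝ), 0 < α → α ≤ 1 → ∀ {CD cD : ℝ}, 0 ≤ CD → 0 < cD →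
    ∃ A M₂ : ℝ, 0 ≤ A ∧ 0 < M₂ ∧
    ∀ (m K : ℕ) {Mh k R : ℕ} {P' : Fin (d + 1) → ℕ}
      (hN : ∀ μ, N0 ℓ Mh k P' μ = (PV d ℓ m K hd hL).sitesPerDir 0) (D : TDomains d ℓ Mh k P' R) (hk : k ≤ m + K) (_ : 1 ≤ k)
      {a : ℕ} (hMha : Mh = (ℓ + 1) ^ a) (hM8 : 8 ≤ Mh) (_ : 2 * (ℓ + 1) ^ 2 ≤ R) (hP : ∀ μ, 5 * (ℓ + 1) ≤ P' μ) (_ : 4 ≤ ℓ)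
      (_ : M₂ ≤ ((ℓ : ℝ) + 1) * Mh)
      {cf : ℝ} (hcf : cf ≠ 0) {w : BondIdx (domT hN D hk) → ℝ} (hw : ∀ i, 0 < w i) (_ : GlobalBand b₀ b₁ cf w)
      (_ : ∀ c : ↥(cubes (padT D (hLP_of_V1 hN hMha hP)).toDomains),
        HasMajorant (g := geomTB (padT D (hLP_of_V1 hN hMha hP))) (blkV1 (hN_pad hN (hLP_of_V1 hN hMha hP)) (padT D (hLP_of_V1 hN hMha hP)))
        (mulOp (zB (hN_pad hN (hLP_of_V1 hN hMha hP)) (padT D (hLP_of_V1 hN hMha hP)) (one_le_of_eight_le hM8)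
            (four_le_of_five_le (hP5_of_V1 hP)) c) *
          (onFun (dE (P := PV d ℓ m K hd hL) cf ∘ₗ
              (LinearMap.id - RE (domT (hN_pad hN (hLP_of_V1 hN hMha hP)) (padT D (hLP_of_V1 hN hMha hP)) (hk'_of_V1 hN hMha hP)) cf) ∘ₗ dsE cf) -
            Pl (hN_pad hN (hLP_of_V1 hN hMha hP)) (hk'_of_V1 hN hMha hP) (one_le_of_eight_le hM8) (four_le_of_five_le (hP5_of_V1 hP)) hMha c
              (band_le (d := d) (ℓ := ℓ) hb₀ hb₁) (placed_pad D (hLP_of_V1 hN hMha hP) (hP5_of_V1 hP) c)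
              (w ∘ (sameOm_domT_pad hN D hk (hLP_of_V1 hN hMha hP) (hk'_of_V1 hN hMha hP)).idxB) cf) *
          mulOp (hB (hN_pad hN (hLP_of_V1 hN hMha hP)) (padT D (hLP_of_V1 hN hMha hP)) c))
        (fun y y'' => CD * cf ^ 2 * Real.exp (-(cD * (geomTB (padT D (hLP_of_V1 hN hMha hP))).M)) /
          (geomTB (padT D (hLP_of_V1 hN hMha hP))).len y ^ 2 * Real.exp (-((2 * σ) * (geomTB (padT D (hLP_of_V1 hN hMha hP))).dist y y'')))),
      HasMajorant (g := geomT D) (blkV1 hN D) (onFun (GE (domT hN D hk) hcf hw))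
        (fun y y' => A * pref cf y * Real.exp (-(delta3 α (2 * σ) * (geomT D).dist y y'))) := by
  obtain ⟨σ₀, hσ₀, h⟩ := prop26_2136_kLevel_final_pad_M d ℓ hd hL hb₀ hb₁
  refine ⟨σ₀, hσ₀, fun σ hσ0 hσle α hα0 hα1 CD cD hCD hcD => ?_⟩
  obtain ⟨A, M₂, hA, hM₂, h2⟩ := h σ hσ0 hσle α hα0 hα1 hCD hcD
  refine ⟨A, M₂, hA, hM₂, ?_⟩
  intro m K Mh k R P' hN D hk hk1 a hMha hM8 hR2 hP hℓ hLM cf hcf w hw hwb hD3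
  exact h2 m K hN D hk (hk'_of_V1 hN hMha hP) hk1 hMha hM8 hR2 (hLP_of_V1 hN hMha hP) (hP5_of_V1 hP) hℓ hLM hcf hw hwb hD3

end Budget

end

end Literature.MathematicalPhysics.QuantumFieldTheory.Balaban1983to89.B6Prop26KLevelAssemblyPadV1
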